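import Summits.AnomalousDissipation.AnomalousDissipation.Theses.EnsembleRigidity
import Summits.AnomalousDissipation.AnomalousDissipation.Theorems.GPStatisticalRigidity.Negative.LoadBearing
import Literature.Analysis.FunctionSpaces.TorusFluidGlueProofs
import Literature.Analysis.FunctionSpaces.TorusFourierCalculus
import Literature.Analysis.FluidPDE.StatisticalSolutionDirac

/-!
# The Dirac shadow of `EnsembleRigidity.GPStatisticalRigidity` (stmt-AnomalousDissipation-15508):
# the crux contains single-field Lamb rigidity of `f_GP` at EVERY energy level — negative side

cdisprove seat `refuter-cdisprove-stmt-AnomalousDissipation-15508-0` (2026-08-16). Kernel-checked form of the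
route text's remark "at a Dirac mass this is VirtualDissipation's single-field rigidity at level `E` (plus
`(f,v) ≥ 0`)", with the work-sign clause REMOVED by the symmetry `U ↦ −U` (the Euler residual `(U·∇)U − f` and
`‖∇U‖` are even, the work `(U, f)` is odd). Consequences (nothing here asserts a Theses statement):

* `lambRigidWithWork_of_rigidAt` — `RigidAt f E c δ₀` (the `∀ μ` body of the crux) tested on the Dirac mass at the
  `H`-state of a smooth solenoidal mean-zero field gives single-field Lamb rigidity with work sign;
* `lambRigid_of_lambRigidWithWork` — the work-sign hypothesis is void (`U ↦ −U`);
* `lambRigid_of_crux` — the crux yields, at EVERY level `E`, constants `c, δ₀ > 0` with `LambRigidAt f_GP E c δ₀`,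
  whose body is, clause for clause, the `∀ u … ∀ R …` body of `VirtualDissipation.LambRigidGP` (stmt-15150, there
  packaged as `∃ E ≥ 2, ∃ c δ₀`); so
* `not_gpStatisticalRigidity_of_lambSoft` — a near-dodger SEQUENCE of smooth fields at ONE bounded energy level
  (`Rₙ‖∇Uₙ‖ → 0` along residual bounds `Rₙ → 0`, ANY sign of the work) refutes this crux; in particular every
  refutation of `LambRigidGP` by bounded-energy near-dodgers (not only by an exact dodger) transfers to this route,
  sharpening the route's KILL CRITERIA sentence "refuted by a near-dodger SEQUENCE only … does not automatically".
-/

noncomputable section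

open MeasureTheory UnitAddTorus
open scoped InnerProductSpace ENNReal

set_option linter.dupNamespace false

namespace Summit.AnomalousDissipation.AnomalousDissipation.Theorems.GPStatisticalRigidity.Negative

open Literature.Analysis.FunctionSpaces Literature.Analysis.FunctionSpaces.Torus Literature.Analysis.FluidPDE
open Summit.AnomalousDissipation.AnomalousDissipation.Theses.EnsembleRigidity
open Summit.AnomalousDissipation.AnomalousDissipation.Theorems.TaylorCertificatePair.Negative

/-! ## Single-field statements -/

/-- The `H⁻¹`-type Euler residual bound of one field: `|∫⟪(U·∇)U − f, w⟫| ≤ R‖∇w‖₂` for all test fields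
`w ∈ 𝒱` (verbatim the residual clause of `VirtualDissipation.LambRigidGP`). -/
def ResidualLE (f U : UnitAddTorus (Fin 3) → EuclideanSpace ℝ (Fin 3)) (R : ℝ) : Prop :=
  ∀ w : UnitAddTorus (Fin 3) → EuclideanSpace ℝ (Fin 3), IsSmooth w → IsDivFree w → HasZeroMean w →
    |∫ x, ⟪convect U U x - f x, w x⟫_ℝ| ≤ R * Real.sqrt (gradNormSq w)

/-- Single-field Lamb rigidity of `f` at level `E` WITH the work sign `(U, f) ≥ 0` (the literal Dirac
instance of the crux). -/
def LambRigidWithWorkAt (f : UnitAddTorus (Fin 3) → EuclideanSpace ℝ (Fin 3)) (E c δ₀ : ℝ) : Prop :=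
  ∀ U : UnitAddTorus (Fin 3) → EuclideanSpace ℝ (Fin 3), IsSmooth U → IsDivFree U → HasZeroMean U →
    ∫ x, ‖U x‖ ^ 2 ≤ E → 0 ≤ ∫ x, ⟪U x, f x⟫_ℝ →
      ∀ R : ℝ, 0 ≤ R → R ≤ δ₀ → ResidualLE f U R → c ≤ R * Real.sqrt (gradNormSq U)

/-- Single-field Lamb rigidity of `f` at level `E` (no work sign): the `∀ u … ∀ R …` body of
`VirtualDissipation.LambRigidGP` at level `E` with constants `c, δ₀`. -/
def LambRigidAt (f : UnitAddTorus (Fin 3) → EuclideanSpace ℝ (Fin 3)) (E c δ₀ : ℝ) : Prop :=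
  ∀ U : UnitAddTorus (Fin 3) → EuclideanSpace ℝ (Fin 3), IsSmooth U → IsDivFree U → HasZeroMean U →
    ∫ x, ‖U x‖ ^ 2 ≤ E →
      ∀ R : ℝ, 0 ≤ R → R ≤ δ₀ → ResidualLE f U R → c ≤ R * Real.sqrt (gradNormSq U)

/-! ## Small calculus complements (local copies of import-unreachable survivors) -/

/-- `D(−w) = −Dw` on `T³` (copy of `OnsagerBDSVGluingStabilityHolds.fderiv_fun_neg'`). -/
theorem fderiv_fun_neg'' {F : Type*} [NormedAddCommGroup F] [NormedSpace ℝ F]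
    (f : UnitAddTorus (Fin 3) → F) (x : UnitAddTorus (Fin 3)) :
    Torus.fderiv (fun y => -f y) x = -Torus.fderiv f x := by
  unfold Torus.fderiv
  rw [show liftAt (fun y => -f y) x = fun v => -(liftAt f x v) from rfl]
  exact _root_.fderiv_fun_neg

/-- `((−u)·∇)(−u) = (u·∇)u` (copy of `OnsagerBDSVGluingStabilityHolds.convect_neg_neg`). -/
theorem convect_neg_neg' (u : UnitAddTorus (Fin 3) → EuclideanSpace ℝ (Fin 3)) (x : UnitAddTorus (Fin 3)) :
    convect (fun y => -u y) (fun y => -u y) x = convect u u x := by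
  simp only [Torus.convect]
  rw [fderiv_fun_neg'']
  simp

/-- `div(−v) = −div v` pointwise (copy of `ScalarTransportDuality.divergence_neg'`). -/
theorem divergence_neg'' (v : UnitAddTorus (Fin 3) → EuclideanSpace ℝ (Fin 3)) (x : UnitAddTorus (Fin 3)) :
    Torus.divergence (fun y => -v y) x = -Torus.divergence v x := by
  simp only [Torus.divergence, Torus.partialDeriv, Torus.lineDeriv, PiLp.neg_apply, deriv.fun_neg,
    Finset.sum_neg_distrib]

/-- `∂ᵢ(−w) = −∂ᵢ w` pointwise (copy of `OnsagerBDSVStagesProofs.partialDeriv_neg_apply`). -/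
theorem partialDeriv_neg_apply' {F : Type*} [NormedAddCommGroup F] [NormedSpace ℝ F]
    (w : UnitAddTorus (Fin 3) → F) (i : Fin 3) (x : UnitAddTorus (Fin 3)) :
    Torus.partialDeriv i (fun y => -w y) x = -Torus.partialDeriv i w x := by
  simp only [Torus.partialDeriv, Torus.lineDeriv]
  exact deriv.neg

/-- `‖∇(−U)‖₂² = ‖∇U‖₂²`. -/
theorem gradNormSq_fun_neg (U : UnitAddTorus (Fin 3) → EuclideanSpace ℝ (Fin 3)) :
    gradNormSq (fun y => -U y) = gradNormSq U := by
  unfold gradNormSq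
  refine integral_congr_ae (ae_of_all _ fun x => ?_)
  simp only [partialDeriv_neg_apply', norm_neg]

/-! ## The work sign is void -/

/-- `U ↦ −U` removes the work-sign clause: the residual `(U·∇)U − f` and `‖∇U‖` are even, `(U,f)` is odd. -/
theorem lambRigid_of_lambRigidWithWork {f : UnitAddTorus (Fin 3) → EuclideanSpace ℝ (Fin 3)} {E c δ₀ : ℝ}
    (h : LambRigidWithWorkAt f E c δ₀) : LambRigidAt f E c δ₀ := by
  intro U hU hdiv hzm hE R hR0 hRδ hres
  by_cases hw : 0 ≤ ∫ x, ⟪U x, f x⟫_ℝ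
  · exact h U hU hdiv hzm hE hw R hR0 hRδ hres
  · -- flip the field
    have hU' : IsSmooth (fun y => -U y) := hU.neg
    have hdiv' : IsDivFree (fun y => -U y) := fun x => by rw [divergence_neg'', hdiv x, neg_zero]
    have hzm' : HasZeroMean (fun y => -U y) := by
      unfold HasZeroMean at hzm ⊢
      rw [integral_neg, hzm, neg_zero]
    have hE' : ∫ x, ‖(fun y => -U y) x‖ ^ 2 ≤ E := by simpa only [norm_neg] using hE
    have hw' : 0 ≤ ∫ x, ⟪(fun y => -U y) x, f x⟫_ℝ := by
      simp only [inner_neg_left, integral_neg]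
      linarith [lt_of_not_ge hw]
    have hres' : ResidualLE f (fun y => -U y) R := by
      intro w hws hwd hwz
      have : (fun x => ⟪convect (fun y => -U y) (fun y => -U y) x - f x, w x⟫_ℝ) =
          fun x => ⟪convect U U x - f x, w x⟫_ℝ := by
        funext x; rw [convect_neg_neg']
      rw [this]
      exact hres w hws hwd hwz
    have key := h (fun y => -U y) hU' hdiv' hzm' hE' hw' R hR0 hRδ hres'
    rwa [gradNormSq_fun_neg] at key

/-! ## The Dirac instance of the crux -/

/-- The inertial pairing on a smooth representative is minus the convective pairing:
`∫⟪Dw·U, U⟫ = −∫⟪(U·∇)U, w⟫`. -/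
theorem integral_inner_fderiv_apply_eq_neg {U w : UnitAddTorus (Fin 3) → EuclideanSpace ℝ (Fin 3)}
    (hU : IsSmooth U) (hdiv : IsDivFree U) (hw : IsSmooth w) :
    ∫ x, ⟪Torus.fderiv w x (U x), U x⟫_ℝ = -∫ x, ⟪convect U U x, w x⟫_ℝ := by
  change ∫ x, ⟪convect U w x, U x⟫_ℝ = _
  rw [integral_inner_convect_eq_neg hU hdiv hw hU]
  congr 1
  exact integral_congr_ae (ae_of_all _ fun x => real_inner_comm _ _)

/-- **Dirac instance.** The `∀ μ` body of the crux, tested on the Dirac mass at the `H`-state of a smooth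
divergence-free mean-zero field, is single-field Lamb rigidity with work sign. -/
theorem lambRigidWithWork_of_rigidAt {f : UnitAddTorus (Fin 3) → EuclideanSpace ℝ (Fin 3)} (hf : IsSmooth f)
    {E c δ₀ : ℝ} (h : RigidAt f E c δ₀) : LambRigidWithWorkAt f E c δ₀ := by
  intro U hU hdiv hzm hE hwork R hR0 hRδ hres
  -- the state of `U`
  have hmem : (hU.memLp 2).toLp U ∈ Torus.energySpace (Fin 3) :=
    smoothSolenoidal_subset_energySpace ⟨U, hU, hdiv, hzm, MemLp.coeFn_toLp _⟩
  set u : Torus.energySpace (Fin 3) := ⟨(hU.memLp 2).toLp U, hmem⟩ with hu_def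
  have hu : ((u : Lp (EuclideanSpace ℝ (Fin 3)) 2 (volume : Measure (UnitAddTorus (Fin 3)))) :
      UnitAddTorus (Fin 3) → EuclideanSpace ℝ (Fin 3)) =ᵐ[volume] U := (hU.memLp 2).coeFn_toLp
  have hGu : Torus.ensembleEnstrophy (Measure.dirac u) = eGradNormSq U := by
    unfold Torus.ensembleEnstrophy
    rw [lintegral_dirac, eGradNormSq_congr_ae' hu]
  -- the hypotheses of `RigidAt` at `δ_u`
  have hI : Integrable (fun v : Torus.energySpace (Fin 3) => ‖v‖ ^ 2) (Measure.dirac u) :=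
    (integrable_const (‖u‖ ^ 2)).congr (ae_eq_dirac (fun v : Torus.energySpace (Fin 3) => ‖v‖ ^ 2)).symm
  have hEn : Torus.ensembleEnergy (Measure.dirac u) ≤ E := by
    unfold Torus.ensembleEnergy
    rw [integral_dirac, norm_sq_of_ae hu]
    exact hE
  have hG : Torus.ensembleEnstrophy (Measure.dirac u) < ⊤ := by
    rw [hGu]; exact eGradNormSq_lt_top hU
  have hS : ShellWorkNonneg f (Measure.dirac u) := by
    intro e₁ e₂ _
    refine integral_nonneg_of_ae (ae_restrict_of_ae ?_)
    filter_upwards [ae_eq_dirac (fun v : Torus.energySpace (Fin 3) =>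
      Torus.pairing (v : Lp (EuclideanSpace ℝ (Fin 3)) 2 (volume : Measure (UnitAddTorus (Fin 3)))) f)] with v hv
    rw [hv]
    have : 0 ≤ Torus.pairing (u : Lp (EuclideanSpace ℝ (Fin 3)) 2 (volume : Measure (UnitAddTorus (Fin 3)))) f := by
      rw [pairing_of_ae hu]; exact hwork
    simpa using this
  have hD : DefectLE f (Measure.dirac u) R := by
    intro Φ
    refine ⟨(integrable_const (Torus.nsGeneratorPairing 0 f u (Φ.grad u))).congr
      (ae_eq_dirac (fun v : Torus.energySpace (Fin 3) => Torus.nsGeneratorPairing 0 f v (Φ.grad v))).symm, ?_⟩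
    rw [integral_dirac, integral_dirac]
    have hws : IsSmooth (Φ.grad u) := Torus.CylindricalTest.isSmooth_grad_holds Φ u
    have hwd : IsDivFree (Φ.grad u) := Torus.CylindricalTest.isDivFree_grad_holds Φ u
    have hwz : HasZeroMean (Φ.grad u) := Torus.CylindricalTest.hasZeroMean_grad_holds Φ u
    rw [nsGeneratorPairing_of_ae hu, zero_mul, add_zero, integral_inner_fderiv_apply_eq_neg hU hdiv hws]
    have i1 : Integrable (fun x => ⟪convect U U x, Φ.grad u x⟫_ℝ) volume := ((hU.convect hU).inner hws).integrable
    have i2 : Integrable (fun x => ⟪f x, Φ.grad u x⟫_ℝ) volume := (hf.inner hws).integrable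
    have hsplit : (∫ x, ⟪f x, Φ.grad u x⟫_ℝ) + -∫ x, ⟪convect U U x, Φ.grad u x⟫_ℝ =
        -∫ x, ⟪convect U U x - f x, Φ.grad u x⟫_ℝ := by
      simp_rw [inner_sub_left]
      rw [integral_sub i1 i2]
      ring
    rw [hsplit, abs_neg]
    exact hres _ hws hwd hwz
  have key := h (Measure.dirac u) inferInstance hI hEn hG hS R hR0 hRδ hD
  rwa [hGu, ← gradNormSq_eq_toReal_eGradNormSq_holds hU] at key

/-- The pinned force is smooth (landed admissibility `stub_gpAdmissible`). -/
theorem isSmooth_gpForce : IsSmooth gpForce :=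
  (Summit.AnomalousDissipation.AnomalousDissipation.Theorems.SteadyStatesLoudBounded.GpAdmissible.stub_gpAdmissible).1

/-- **The crux contains single-field Lamb rigidity of `f_GP` at every level** (no work sign). -/
theorem lambRigid_of_crux (h : GPStatisticalRigidity) (E : ℝ) :
    ∃ c δ₀ : ℝ, 0 < c ∧ 0 < δ₀ ∧ LambRigidAt gpForce E c δ₀ := by
  obtain ⟨c, δ₀, hc, hδ₀, hrig⟩ := rigid_of_crux h E
  exact ⟨c, δ₀, hc, hδ₀, lambRigid_of_lambRigidWithWork (lambRigidWithWork_of_rigidAt isSmooth_gpForce hrig)⟩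

/-- **Kill switch (near-dodger sequences).** If at ONE level `E` single-field Lamb rigidity of `f_GP` fails for
all constants — i.e. there are smooth divergence-free mean-zero fields of energy `≤ E` with residual bounds
`R ≤ δ₀` and `R‖∇U‖₂ < c` for every `c, δ₀ > 0` (any sign of the work) — the crux is false. -/
theorem not_gpStatisticalRigidity_of_lambSoft
    (hsoft : ∃ E : ℝ, ∀ c δ₀ : ℝ, 0 < c → 0 < δ₀ → ¬ LambRigidAt gpForce E c δ₀) : ¬ GPStatisticalRigidity := by
  rintro h
  obtain ⟨E, hE⟩ := hsoft
  obtain ⟨c, δ₀, hc, hδ₀, hrig⟩ := lambRigid_of_crux h E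
  exact hE c δ₀ hc hδ₀ hrig

end Summit.AnomalousDissipation.AnomalousDissipation.Theorems.GPStatisticalRigidity.Negative
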